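import Summits.SmoothPoincare4.SmoothPoincare4.Theorems.EntropyRungConicalGapSecondWeightedIdentity
import Summits.SmoothPoincare4.SmoothPoincare4.Theorems.EntropyRungConicalGapScaleDerivatives
import Summits.SmoothPoincare4.SmoothPoincare4.Theorems.EntropyRungConicalGapSelfSimilarEntropy
import HarnessLib

/-!
# Helper `helper_coneExcess_monotoneOn` of line `Sketch`
# (crux `EntropyRung.ConicalGap`, stmt-SmoothPoincare4-16589; lead seat c3, cycle 3, wave 3)

On a complete connected normalised 4-d gradient shrinking Ricci soliton `(M, g, f)` (`Ric + Hess f = g/2`,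
`R + |∇f|² = f`, closed `g`-balls compact) write, for a scale `τ > 0` (all integrals `dV`),

  `Z(τ) = ∫ e^{-f/τ}`, `N(τ) = ∫ R e^{-f/τ}`, `F(τ) = ∫ f e^{-f/τ}`, `G(τ) = ∫ f R e^{-f/τ}`,
  `m(τ) = τ ⟨R⟩_τ = τ N(τ)/Z(τ)`  (the CONE-EXCESS PROFILE of the half-sup fence).

By the scale derivatives `Z′ = τ⁻² F`, `N′ = τ⁻² G` (`helper_scaleDerivatives`; the five weights are
integrable by `weightedIntegrability_riemVolume` and `secondWeightedIdentity_integrable`) and the quotient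
rule (`helper_coneExcess_hasDerivAt`),

  `m′(τ) = N/Z + τ⁻¹ (G/Z − (F/Z)(N/Z))`,

and, inserting the first weighted identity `F = 2τ Z + (1 − τ) N` (`secondWeightedIdentity_firstIdentity`),

  `τ Z² m′(τ) = Z (G − τ N) + (τ − 1) N²`,  `G − τ N = ∫ (f − τ) R e^{-f/τ}`.

Hence the curvature-level sign condition `P(τ) : ∫ (f − τ) R e^{-f/τ} dV ≥ 0` for `τ ≥ 1` gives `m′ ≥ 0`
on `[1, ∞)` (`Z > 0` by `selfSimilar_weight_pos`), and `m` is non-decreasing on `[1, ∞)` by the mean value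
theorem (`monotoneOn_of_deriv_nonneg`). This is the registered helper `helper_coneExcess_monotoneOn`:
it reduces the monotonicity of the cone-excess profile (under which the half-sup fence reads
`Θ ≤ a e^{ρ/2}`, `ρ = lim m`) to `P`.

Everything here is proved; no definition and no named fact is introduced or assumed.

## References

* Y. Wang, G. Wang (Wang–Wang 2023), arXiv:2308.06560, Prop. 2.6, (2.7)–(2.10).
* [CarrilloNi2009] J. Carrillo, L. Ni, Comm. Anal. Geom. 17 (2009) 721–753, §2, §4 (weighted identities).
-/

noncomputable section

-- `Summit.SmoothPoincare4.SmoothPoincare4.…` (summit = problem) trips `dupNamespace` on every decl.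
set_option linter.dupNamespace false

open scoped Manifold ContDiff ENNReal NNReal Topology
open MeasureTheory Set Filter
open Literature.Geometry.Lorentzian Literature.Geometry.Riemannian

namespace Summit.SmoothPoincare4.SmoothPoincare4.Theorems.ConicalGapSketch

/-! ## The sign of the derivative value (pure algebra) -/

/-- **The derivative value of the cone-excess profile is non-negative**: if `z > 0`, `τ ≥ 1`,
`F − 2τ z = (1 − τ) N` (first weighted identity) and `0 ≤ G − τ N` (the sign condition `P(τ)`), then
`0 ≤ N/z + τ⁻¹ (G/z − (F/z)(N/z))`; indeed
`τ z² · (N/z + τ⁻¹ (G/z − (F/z)(N/z))) = z (G − τ N) + (τ − 1) N²`. -/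
theorem coneExcessMono_derivValue_nonneg {z N F G τ : ℝ} (hz : 0 < z) (hτ : 1 ≤ τ)
    (hid : F - 2 * τ * z = (1 - τ) * N) (hP : 0 ≤ G - τ * N) :
    0 ≤ N / z + τ⁻¹ * (G / z - (F / z) * (N / z)) := by
  have hτ0 : 0 < τ := by linarith
  have hF : F = 2 * τ * z + (1 - τ) * N := by linarith
  have hval : N / z + τ⁻¹ * (G / z - (F / z) * (N / z)) =
      (z * (G - τ * N) + (τ - 1) * N ^ 2) / (τ * z ^ 2) := by
    rw [hF]
    field_simp
    ring
  rw [hval]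
  exact div_nonneg (add_nonneg (mul_nonneg hz.le hP) (mul_nonneg (by linarith) (sq_nonneg _)))
    (by positivity)

/-! ## The cone-excess profile over `g.riemVolume` (n = 4) -/

section RiemVolume

variable {M : Type} [TopologicalSpace M] [T2Space M] [SecondCountableTopology M]
  [ChartedSpace (EuclideanSpace ℝ (Fin 4)) M] [IsManifold (𝓡 4) ∞ M] [ConnectedSpace M]
  [T3Space M] [MeasurableSpace M] [BorelSpace M]

/-- **The scale derivative of the cone-excess profile** (over `g.riemVolume`): on a complete connected
normalised 4-d gradient shrinker, for every `τ > 0`, `m(s) = s N(s)/Z(s)` has derivative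
`N/Z + τ⁻¹ (G/Z − (F/Z)(N/Z))` at `τ`, where `Z = ∫ e^{-f/τ}`, `N = ∫ R e^{-f/τ}`, `F = ∫ f e^{-f/τ}`,
`G = ∫ f R e^{-f/τ}` (`helper_scaleDerivatives` + `helper_coneExcess_hasDerivAt`). -/
theorem coneExcessMono_hasDerivAt
    (g : PseudoRiemannianMetric (𝓡 4) ∞ (EuclideanSpace ℝ (Fin 4)) (TangentSpace (𝓡 4) : M → Type _))
    [g.HasLeviCivita] (f : M → ℝ) (hg : g.IsRiemannian)
    (hc : ∀ (x : M) (r : NNReal), IsCompact {y : M | g.edist hg x y ≤ r})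
    (hf : ContMDiff (𝓡 4) 𝓘(ℝ, ℝ) ∞ f)
    (hsol : ∀ (x : M) (X Y : TangentSpace (𝓡 4) x),
      g.ricci x X Y + g.hessian f x X Y = (1 / 2 : ℝ) * g.val x X Y)
    (hnorm : ∀ x : M, g.scalarCurvature x + g.gradSq f x = f x) {τ : ℝ} (hτ : 0 < τ) :
    HasDerivAt (fun s : ℝ ↦ s * ((∫ x, g.scalarCurvature x * Real.exp (-f x / s) ∂g.riemVolume) /
        (∫ x, Real.exp (-f x / s) ∂g.riemVolume)))
      ((∫ x, g.scalarCurvature x * Real.exp (-f x / τ) ∂g.riemVolume) /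
          (∫ x, Real.exp (-f x / τ) ∂g.riemVolume) +
        τ⁻¹ * ((∫ x, f x * g.scalarCurvature x * Real.exp (-f x / τ) ∂g.riemVolume) /
            (∫ x, Real.exp (-f x / τ) ∂g.riemVolume) -
          ((∫ x, f x * Real.exp (-f x / τ) ∂g.riemVolume) /
              (∫ x, Real.exp (-f x / τ) ∂g.riemVolume)) *
            ((∫ x, g.scalarCurvature x * Real.exp (-f x / τ) ∂g.riemVolume) /
              (∫ x, Real.exp (-f x / τ) ∂g.riemVolume)))) τ := by
  obtain ⟨hR0, -, hprop⟩ :=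
    NoncompactShrinkerGapCarrilloNiClauses.scalarCurvature_nonneg_and_isCompact_sublevel g f hg hc hf
      hsol hnorm
  have hf0 : ∀ x, 0 ≤ f x := fun x ↦ by linarith [hnorm x, hR0 x, g.gradSq_nonneg hg f x]
  have hRc : Continuous fun x ↦ g.scalarCurvature x :=
    (PseudoRiemannianMetric.contMDiff_scalarCurvature g).continuous
  -- the five weights are integrable at every scale
  have hint : ∀ σ : ℝ, 0 < σ → Integrable (fun x ↦ Real.exp (-f x / σ)) g.riemVolume ∧
      Integrable (fun x ↦ f x * Real.exp (-f x / σ)) g.riemVolume ∧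
      Integrable (fun x ↦ g.scalarCurvature x * Real.exp (-f x / σ)) g.riemVolume := fun σ hσ ↦
    weightedIntegrability_riemVolume hg hf hsol hnorm hprop hR0 hσ
  have hint2 : ∀ σ : ℝ, 0 < σ → Integrable (fun x ↦ f x ^ 2 * Real.exp (-f x / σ)) g.riemVolume ∧
      Integrable (fun x ↦ f x * g.scalarCurvature x * Real.exp (-f x / σ)) g.riemVolume := fun σ hσ ↦
    secondWeightedIdentity_integrable hg hf hsol hnorm hprop hR0 hσ
  -- the scale derivatives `Z′ = τ⁻² F`, `N′ = τ⁻² G`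
  obtain ⟨hZ', -, hN'⟩ := helper_scaleDerivatives M g.riemVolume f (fun x ↦ g.scalarCurvature x)
    hf.continuous.measurable hRc.measurable hf0 hR0 hint hint2 τ hτ
  -- `Z > 0`
  have hZpos : 0 < ∫ x, Real.exp (-f x / τ) ∂g.riemVolume :=
    selfSimilar_weight_pos g f hg τ (hint τ hτ).1
  -- the quotient rule
  exact helper_coneExcess_hasDerivAt (fun s ↦ ∫ x, Real.exp (-f x / s) ∂g.riemVolume)
    (fun s ↦ ∫ x, g.scalarCurvature x * Real.exp (-f x / s) ∂g.riemVolume) τ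
    (∫ x, f x * Real.exp (-f x / τ) ∂g.riemVolume)
    (∫ x, f x * g.scalarCurvature x * Real.exp (-f x / τ) ∂g.riemVolume) hτ.ne' hZpos.ne' hZ' hN'

/-- **The cone excess as a difference of moments** (over `g.riemVolume`): for `τ > 0`,
`∫ (f − τ) R e^{-f/τ} = ∫ f R e^{-f/τ} − τ ∫ R e^{-f/τ}` (both weights integrable on a complete
normalised 4-d shrinker). -/
theorem coneExcessMono_excess_eq
    (g : PseudoRiemannianMetric (𝓡 4) ∞ (EuclideanSpace ℝ (Fin 4)) (TangentSpace (𝓡 4) : M → Type _))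
    [g.HasLeviCivita] (f : M → ℝ) (hg : g.IsRiemannian)
    (hc : ∀ (x : M) (r : NNReal), IsCompact {y : M | g.edist hg x y ≤ r})
    (hf : ContMDiff (𝓡 4) 𝓘(ℝ, ℝ) ∞ f)
    (hsol : ∀ (x : M) (X Y : TangentSpace (𝓡 4) x),
      g.ricci x X Y + g.hessian f x X Y = (1 / 2 : ℝ) * g.val x X Y)
    (hnorm : ∀ x : M, g.scalarCurvature x + g.gradSq f x = f x) {τ : ℝ} (hτ : 0 < τ) :
    ∫ x, (f x - τ) * g.scalarCurvature x * Real.exp (-f x / τ) ∂g.riemVolume =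
      (∫ x, f x * g.scalarCurvature x * Real.exp (-f x / τ) ∂g.riemVolume) -
        τ * ∫ x, g.scalarCurvature x * Real.exp (-f x / τ) ∂g.riemVolume := by
  obtain ⟨hR0, -, hprop⟩ :=
    NoncompactShrinkerGapCarrilloNiClauses.scalarCurvature_nonneg_and_isCompact_sublevel g f hg hc hf
      hsol hnorm
  obtain ⟨-, -, iR⟩ := weightedIntegrability_riemVolume hg hf hsol hnorm hprop hR0 hτ
  obtain ⟨-, iFR⟩ := secondWeightedIdentity_integrable hg hf hsol hnorm hprop hR0 hτ
  have hsplit : ∀ x, (f x - τ) * g.scalarCurvature x * Real.exp (-f x / τ) =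
      f x * g.scalarCurvature x * Real.exp (-f x / τ) -
        τ * (g.scalarCurvature x * Real.exp (-f x / τ)) := fun x ↦ by ring
  simp_rw [hsplit]
  rw [integral_sub iFR (iR.const_mul _), integral_const_mul]

/-- **Monotonicity of the cone-excess profile from the sign condition** (over `g.riemVolume`): on a
complete connected normalised 4-d gradient shrinker, if `∫ (f − τ) R e^{-f/τ} dV ≥ 0` for every `τ ≥ 1`,
then `τ ↦ τ ⟨R⟩_τ` is non-decreasing on `[1, ∞)`: `τ Z² m′ = Z (G − τ N) + (τ − 1) N² ≥ 0`
(`coneExcessMono_hasDerivAt`, `secondWeightedIdentity_firstIdentity`, `coneExcessMono_derivValue_nonneg`)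
and the mean value theorem `monotoneOn_of_deriv_nonneg` on the convex set `[1, ∞)`. -/
theorem coneExcessMono_monotoneOn
    (g : PseudoRiemannianMetric (𝓡 4) ∞ (EuclideanSpace ℝ (Fin 4)) (TangentSpace (𝓡 4) : M → Type _))
    [g.HasLeviCivita] (f : M → ℝ) (hg : g.IsRiemannian)
    (hc : ∀ (x : M) (r : NNReal), IsCompact {y : M | g.edist hg x y ≤ r})
    (hf : ContMDiff (𝓡 4) 𝓘(ℝ, ℝ) ∞ f)
    (hsol : ∀ (x : M) (X Y : TangentSpace (𝓡 4) x),
      g.ricci x X Y + g.hessian f x X Y = (1 / 2 : ℝ) * g.val x X Y)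
    (hnorm : ∀ x : M, g.scalarCurvature x + g.gradSq f x = f x)
    (hP : ∀ τ : ℝ, 1 ≤ τ →
      0 ≤ ∫ x, (f x - τ) * g.scalarCurvature x * Real.exp (-f x / τ) ∂g.riemVolume) :
    MonotoneOn (fun τ : ℝ ↦ τ * ((∫ x, g.scalarCurvature x * Real.exp (-f x / τ) ∂g.riemVolume) /
      (∫ x, Real.exp (-f x / τ) ∂g.riemVolume))) (Ici 1) := by
  have hder := fun τ (hτ : 0 < τ) ↦ coneExcessMono_hasDerivAt g f hg hc hf hsol hnorm hτ
  refine monotoneOn_of_deriv_nonneg (convex_Ici 1) (fun τ hτ ↦ ?_) ?_ ?_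
  · exact (hder τ (lt_of_lt_of_le one_pos (mem_Ici.mp hτ))).continuousAt.continuousWithinAt
  · rw [interior_Ici]
    exact fun τ hτ ↦ (hder τ (lt_trans one_pos (mem_Ioi.mp hτ))).differentiableAt.differentiableWithinAt
  · rw [interior_Ici]
    intro τ hτ
    have hτ1 : 1 < τ := mem_Ioi.mp hτ
    have hτ0 : 0 < τ := lt_trans one_pos hτ1
    rw [(hder τ hτ0).deriv]
    obtain ⟨hR0, -, hprop⟩ :=
      NoncompactShrinkerGapCarrilloNiClauses.scalarCurvature_nonneg_and_isCompact_sublevel g f hg hc hf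
        hsol hnorm
    have hZpos : 0 < ∫ x, Real.exp (-f x / τ) ∂g.riemVolume :=
      selfSimilar_weight_pos g f hg τ (weightedIntegrability_riemVolume hg hf hsol hnorm hprop hR0 hτ0).1
    have hid := secondWeightedIdentity_firstIdentity g f hg hc hf hsol hnorm hτ0
    have hPτ := hP τ hτ1.le
    rw [coneExcessMono_excess_eq g f hg hc hf hsol hnorm hτ0] at hPτ
    exact coneExcessMono_derivValue_nonneg hZpos hτ1.le hid hPτ

end RiemVolume

/-! ## The registered helper (crux vocabulary) -/

/-- **Helper `helper_coneExcess_monotoneOn` of line `Sketch`** (crux `EntropyRung.ConicalGap`): on every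
complete connected normalised 4-d gradient shrinking Ricci soliton, the curvature-level sign condition
`∫ (f − τ) R e^{-f/τ} dV ≥ 0` for all `τ ≥ 1` implies that the cone-excess profile
`τ ↦ τ ⟨R⟩_τ = τ (∫ R e^{-f/τ} dV)/(∫ e^{-f/τ} dV)` is non-decreasing on `[1, ∞)` (`dV` the Riemannian
measure of `g.toContMDiffRiemannianMetric hg`, to which `g.riemVolume` unfolds by `riemVolume_eq`):
`coneExcessMono_monotoneOn`. -/
theorem helper_coneExcess_monotoneOn : ∀ (M : Type) [TopologicalSpace M] [T2Space M] [SecondCountableTopology M] [ChartedSpace (EuclideanSpace ℝ (Fin 4)) M] [IsManifold (𝓡 4) ∞ M] [ConnectedSpace M] [T3Space M] [MeasurableSpace M] [BorelSpace M] (g : Literature.Geometry.Lorentzian.PseudoRiemannianMetric (𝓡 4) ∞ (EuclideanSpace ℝ (Fin 4)) (TangentSpace (𝓡 4) : M → Type _)) [g.HasLeviCivita] (f : M → ℝ) (hg : g.IsRiemannian), (∀ (x : M) (r : NNReal), IsCompact {y : M | g.edist hg x y ≤ r}) → ContMDiff (𝓡 4) 𝓘(ℝ, ℝ) ∞ f →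 (∀ (x : M) (X Y : TangentSpace (𝓡 4) x), g.ricci x X Y + g.hessian f x X Y = (1 / 2 : ℝ) * g.val x X Y) → (∀ x : M, g.scalarCurvature x + g.gradSq f x = f x) → (∀ τ : ℝ, 1 ≤ τ → 0 ≤ ∫ x, (f x - τ) * g.scalarCurvature x * Real.exp (-f x / τ) ∂(Literature.Geometry.Lorentzian.riemannianMeasure (g.toContMDiffRiemannianMetric hg))) → MonotoneOn (fun τ : ℝ ↦ τ * ((∫ x, g.scalarCurvature x * Real.exp (-f x / τ) ∂(Literature.Geometry.Lorentzian.riemannianMeasure (g.toContMDiffRiemannianMetric hg))) / (∫ x, Real.exp (-f x / τ) ∂(Literature.Geometry.Lorentzian.riemannianMeasure (g.toContMDiffRiemannianMetric hg))))) (Set.Ici 1) := by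
  intro M _ _ _ _ _ _ _ _ _ g _ f hg hc hf hsol hnorm hP
  rw [← PseudoRiemannianMetric.riemVolume_eq hg] at hP ⊢
  exact coneExcessMono_monotoneOn g f hg hc hf hsol hnorm hP

end Summit.SmoothPoincare4.SmoothPoincare4.Theorems.ConicalGapSketch

end
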